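import Summits.AtomisticToContinuum.Crystallization.Theorems.BraggSlacknessRigidityStrictCertificateDesign

/-!
# Crux `StrictCertificate` (stmt-AtomisticToContinuum-13167, route `BraggSlacknessRigidity`, rank 3) —
# ALTERNATIVE line `farfield-core` (crux-strategist s1, 2026-08-17): identify · far field on the box · core completion

The registered line `birth`/`registered` (lead c1–c4) cuts the crux as `stub_hcpPeriodicMinimum ∧ stub_strictDesign`;
its second stub is the crux read at a template (`strictCertificate_iff_exists_design`), i.e. the far-field wall W1 and
the finite-range core W2 TOGETHER, conditioned on template minimality — four lead seats could only land necessary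
conditions on it.  This line separates the two walls and frees the far field from item 3061:

* `stub_hcpPeriodicMinimiser` — item stmt-AtomisticToContinuum-3061 VERBATIM (template identification on the box
  `B = [47/50, 1] × [39/50·a, 17/20·a]`; staffed on its own docket: lines `birth`, split 5831–5833, p146258 gives
  3061 → the registered line's `stub_hcpPeriodicMinimum`);
* `stub_hcpFarFieldOnBox` — W1, 3061-FREE and UNCONDITIONAL: at EVERY hcp template of the box there is a pure far
  field `(ρ, f)`: the crux's Fourier package verbatim (`F = f∘‖·‖` continuous, integrable, `𝓕F` integrable, real,
  `≥ 0`, `≠ 0` off `{0} ∪` Bragg spheres), the forced zero `𝓕F 0 = 0`, one-sided contact `f ≤ V_LJ` on `[ρ,∞)` with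
  contact set EXACTLY `D_P ∩ [ρ,∞)`, and invisibility of the crystal `HasSum (y ↦ f (dist w y)) 0` for every `w`.
  No minimality, no core, no `g`, `U`, `c`: refutable at any single template by one dual (phantom) certificate,
  provable by one (reconstruct-then-verify) construction; necessary for the crux at the witness template
  (`Split.farField_of_strictCertificate`, this seat's support file);
* `stub_hcpCoreCompletion` — W2 with design freedom: at a MINIMISING hcp template, every kernel carrying the tail data
  of a far field (range, Fourier package, strict one-sided contact) can be completed, after modification inside a
  larger ball (`f' = f` on `[ρ',∞)`, `ρ' ≥ ρ`), to a strict design in the periodic normal form of the registered line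
  (`stub_strictDesign`'s conclusion verbatim for `(ρ', f', Uc)`).

Composition `StrictCertificate_of`: minimality is consumed only to pick the template; the design at that template gives
the crux by the LANDED `strictCertificate_of_design` (p146257).  `lean check`: rc 0, sorries 3 = the stubs; BC3 probes
(stubᵢ → crux, stubᵢ → Crystallization by `exact? | simpa | aesop`, 400k heartbeats) fail 6/6.
-/

noncomputable section

namespace Summit.AtomisticToContinuum.Crystallization.Cruxes.StrictCertificate.FarfieldCore

open Summit.AtomisticToContinuum.Crystallization.Theorems.BraggSlacknessRigidityStrictCertificate
  (strictCertificate_of_design)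

/-- **stub_hcpPeriodicMinimiser — TEMPLATE IDENTIFICATION = item stmt-AtomisticToContinuum-3061 verbatim.**
Some relaxed hcp `hcp(a,h)` with `(a,h)` in the box `B` is a least element of the Lennard-Jones energy per
particle over all periodic configurations of `ℝ³`.  Open (Blanc–Lewin 2015 §2.3); necessary for the crux up to the
box (`hcpPeriodicMinimum_of_strictCertificate`, p146257). -/
theorem stub_hcpPeriodicMinimiser : ∃ a h : ℝ, ∃ (ha : a ≠ 0) (hh : h ≠ 0), 47 / 50 ≤ a ∧ a ≤ 1 ∧ 39 / 50 * a ≤ h ∧ h ≤ 17 / 20 * a ∧ IsLeast (Set.range fun Q : Literature.MathematicalPhysics.StatisticalMechanics.PeriodicConfiguration 3 => Q.energyPerParticle Literature.MathematicalPhysics.StatisticalMechanics.lennardJones) ((Literature.MathematicalPhysics.StatisticalMechanics.hcpPeriodicConfiguration ha hh).energyPerParticle Literature.MathematicalPhysics.StatisticalMechanics.lennardJones) := by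
  sorry

/-- **stub_hcpFarFieldOnBox — THE FAR-FIELD WALL W1 ON THE hcp BOX (pure harmonic analysis; 3061-free).**
For every template `hcp(a,h)`, `(a,h) ∈ B`, there are a range `ρ > 0` and a radial kernel `f` with: the crux's
Fourier package (conjuncts 10–14 verbatim), `𝓕F(0) = 0`, `f ≤ V_LJ` on `[ρ,∞)` with `f r = V_LJ r ↔ r ∈ D_P` there,
and invisibility `HasSum (y ↦ f (dist w y)) 0` for every `w ∈ ℝ³`.  Why it might fail: one-sided radial
interpolation with `𝓕F ≥ 0` vanishing on the non-extinct Bragg spheres is supercritical in `d = 3` (sibling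
census W1; `HcpFarFieldEmpty` of the negative lemma p149331 is its negation enriched by necessary clauses). -/
theorem stub_hcpFarFieldOnBox : ∀ (a h : ℝ) (ha : a ≠ 0) (hh : h ≠ 0), 47 / 50 ≤ a → a ≤ 1 → 39 / 50 * a ≤ h → h ≤ 17 / 20 * a → ∃ (ρ : ℝ) (f : ℝ → ℝ), 0 < ρ ∧ Continuous (fun v : EuclideanSpace ℝ (Fin 3) => (f ‖v‖ : ℂ)) ∧ MeasureTheory.Integrable (fun v : EuclideanSpace ℝ (Fin 3) => (f ‖v‖ : ℂ)) ∧ MeasureTheory.Integrable (FourierTransform.fourier (fun v : EuclideanSpace ℝ (Fin 3) => (f ‖v‖ : ℂ))) ∧ (∀ ξ : EuclideanSpace ℝ (Fin 3), (FourierTransform.fourier (fun v : EuclideanSpace ℝ (Fin 3) => (f ‖v‖ : ℂ)) ξ).im = 0 ∧ 0 ≤ (FourierTransform.fourier (fun v : EuclideanSpace ℝ (Fin 3) => (f ‖v‖ : ℂ)) ξ).re) ∧ (∀ ξ : EuclideanSpace ℝ (Fin 3), ξ ≠ 0 → (∀ k : EuclideanSpace ℝ (Fin 3), (∀ g ∈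 (Literature.MathematicalPhysics.StatisticalMechanics.hcpPeriodicConfiguration ha hh).lattice, ∃ n : ℤ, inner ℝ k g = (n : ℝ)) → ‖ξ‖ ≠ ‖k‖) → FourierTransform.fourier (fun v : EuclideanSpace ℝ (Fin 3) => (f ‖v‖ : ℂ)) ξ ≠ 0) ∧ FourierTransform.fourier (fun v : EuclideanSpace ℝ (Fin 3) => (f ‖v‖ : ℂ)) 0 = 0 ∧ (∀ r : ℝ, ρ ≤ r → f r ≤ Literature.MathematicalPhysics.StatisticalMechanics.lennardJones r) ∧ (∀ r : ℝ, ρ ≤ r → (f r = Literature.MathematicalPhysics.StatisticalMechanics.lennardJones r ↔ ∃ p ∈ (Literature.MathematicalPhysics.StatisticalMechanics.hcpPeriodicConfiguration ha hh).points, ∃ q ∈ (Literature.MathematicalPhysics.StatisticalMechanics.hcpPeriodicConfiguration ha hh).points, r = dist p q)) ∧ (∀ w : EuclideanSpace ℝ (Fin 3), HasSum (fun y : (Literature.MathematicalPhysics.StatisticalMechanics.hcpPeriodicConfiguration ha hh).points => f (dist w (y : EuclideanSpace ℝ (Fin 3)))) 0) := by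
  sorry

/-- **stub_hcpCoreCompletion — THE CORE WALL W2 AS COMPLETION (finite-range crystal design at a minimising hcp).**
At a minimising template `hcp(a,h)`, every kernel `f` with the tail data of a far field at range `ρ` (Fourier
package, `f ≤ V_LJ` on `[ρ,∞)` with contact set exactly `D_P`) admits `ρ' ≥ ρ`, a kernel `f'` AGREEING WITH `f` ON
`[ρ',∞)` and a strict continuous core penalty `Uc` forming a strict design in periodic normal form: Fourier package
for `f'`, strict one-sided tail contact, `Uc ≥ 0` on `(0,ρ')` with zeros in `D_P`, gluing value
`Uc ρ' = V_LJ ρ' − f' ρ'`, and the charged periodic core bound `e_LJ(P) + f' 0/2 ≤ e_Q((V_LJ − f' − Uc)·1_{(0,ρ')})` for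
every periodic `Q`.  Why it might fail: finite-range crystallisation in `ℝ³` for a DESIGNED pair potential
(Kepler / Flatley–Theil scale: the remainder must have hcp as exact periodic ground state with finite-`N` stability);
and if far-field tails are non-unique a bad tail might admit no completion. -/
theorem stub_hcpCoreCompletion : ∀ (a h : ℝ) (ha : a ≠ 0) (hh : h ≠ 0), (∀ Q : Literature.MathematicalPhysics.StatisticalMechanics.PeriodicConfiguration 3, (Literature.MathematicalPhysics.StatisticalMechanics.hcpPeriodicConfiguration ha hh).energyPerParticle Literature.MathematicalPhysics.StatisticalMechanics.lennardJones ≤ Q.energyPerParticle Literature.MathematicalPhysics.StatisticalMechanics.lennardJones) → ∀ (ρ : ℝ) (f : ℝ → ℝ), (0 < ρ ∧ Continuous (fun v : EuclideanSpace ℝ (Fin 3) => (f ‖v‖ : ℂ)) ∧ MeasureTheory.Integrable (fun v : EuclideanSpace ℝ (Fin 3) => (f ‖v‖ : ℂ)) ∧ MeasureTheory.Integrable (FourierTransform.fourier (fun v : EuclideanSpace ℝ (Fin 3) => (f ‖v‖ : ℂ))) ∧ (∀ ξ : EuclideanSpace ℝ (Fin 3), (FourierTransform.fourier (fun v : EuclideanSpace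 ℝ (Fin 3) => (f ‖v‖ : ℂ)) ξ).im = 0 ∧ 0 ≤ (FourierTransform.fourier (fun v : EuclideanSpace ℝ (Fin 3) => (f ‖v‖ : ℂ)) ξ).re) ∧ (∀ ξ : EuclideanSpace ℝ (Fin 3), ξ ≠ 0 → (∀ k : EuclideanSpace ℝ (Fin 3), (∀ g ∈ (Literature.MathematicalPhysics.StatisticalMechanics.hcpPeriodicConfiguration ha hh).lattice, ∃ n : ℤ, inner ℝ k g = (n : ℝ)) → ‖ξ‖ ≠ ‖k‖) → FourierTransform.fourier (fun v : EuclideanSpace ℝ (Fin 3) => (f ‖v‖ : ℂ)) ξ ≠ 0) ∧ (∀ r : ℝ, ρ ≤ r → f r ≤ Literature.MathematicalPhysics.StatisticalMechanics.lennardJones r) ∧ (∀ r : ℝ, ρ ≤ r → (f r = Literature.MathematicalPhysics.StatisticalMechanics.lennardJones r ↔ ∃ p ∈ (Literature.MathematicalPhysics.StatisticalMechanics.hcpPeriodicConfiguration ha hh).points, ∃ q ∈ (Literature.MathematicalPhysics.StatisticalMechanics.hcpPeriodicConfiguration ha hh).points, r = dist p q))) → ∃ (ρ' : ℝ) (f'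 Uc : ℝ → ℝ), ρ ≤ ρ' ∧ (∀ r : ℝ, ρ' ≤ r → f' r = f r) ∧ 0 < ρ' ∧ Continuous (fun v : EuclideanSpace ℝ (Fin 3) => (f' ‖v‖ : ℂ)) ∧ MeasureTheory.Integrable (fun v : EuclideanSpace ℝ (Fin 3) => (f' ‖v‖ : ℂ)) ∧ MeasureTheory.Integrable (FourierTransform.fourier (fun v : EuclideanSpace ℝ (Fin 3) => (f' ‖v‖ : ℂ))) ∧ (∀ ξ : EuclideanSpace ℝ (Fin 3), (FourierTransform.fourier (fun v : EuclideanSpace ℝ (Fin 3) => (f' ‖v‖ : ℂ)) ξ).im = 0 ∧ 0 ≤ (FourierTransform.fourier (fun v : EuclideanSpace ℝ (Fin 3) => (f' ‖v‖ : ℂ)) ξ).re) ∧ (∀ ξ : EuclideanSpace ℝ (Fin 3), ξ ≠ 0 → (∀ k : EuclideanSpace ℝ (Fin 3), (∀ g ∈ (Literature.MathematicalPhysics.StatisticalMechanics.hcpPeriodicConfiguration ha hh).lattice, ∃ n : ℤ, inner ℝ k g = (n : ℝ)) → ‖ξ‖ ≠ ‖k‖) → FourierTransform.fourier (fun v : EuclideanSpace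 ℝ (Fin 3) => (f' ‖v‖ : ℂ)) ξ ≠ 0) ∧ (∀ r : ℝ, ρ' ≤ r → f' r ≤ Literature.MathematicalPhysics.StatisticalMechanics.lennardJones r) ∧ (∀ r : ℝ, ρ' ≤ r → f' r = Literature.MathematicalPhysics.StatisticalMechanics.lennardJones r → ∃ p ∈ (Literature.MathematicalPhysics.StatisticalMechanics.hcpPeriodicConfiguration ha hh).points, ∃ q ∈ (Literature.MathematicalPhysics.StatisticalMechanics.hcpPeriodicConfiguration ha hh).points, r = dist p q) ∧ ContinuousOn Uc (Set.Ioc 0 ρ') ∧ (∀ r : ℝ, 0 < r → r < ρ' → 0 ≤ Uc r) ∧ (∀ r : ℝ, 0 < r → r < ρ' → Uc r = 0 → ∃ p ∈ (Literature.MathematicalPhysics.StatisticalMechanics.hcpPeriodicConfiguration ha hh).points, ∃ q ∈ (Literature.MathematicalPhysics.StatisticalMechanics.hcpPeriodicConfiguration ha hh).points, r = dist p q) ∧ Uc ρ' = Literature.MathematicalPhysics.StatisticalMechanics.lennardJones ρ' - f' ρ' ∧ (∀ Q : Literature.MathematicalPhysics.StatisticalMechanics.PeriodicConfiguration 3, (Literature.MathematicalPhysics.StatisticalMechanics.hcpPeriodicConfiguration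 ha hh).energyPerParticle Literature.MathematicalPhysics.StatisticalMechanics.lennardJones + f' 0 / 2 ≤ Q.energyPerParticle (fun r => if r < ρ' then Literature.MathematicalPhysics.StatisticalMechanics.lennardJones r - f' r - Uc r else 0)) := by
  sorry

/-! ## Composition -/

/-- The crux `BraggSlacknessRigidity.StrictCertificate` from the three stubs: pick the minimising template from
stub 1, a far field there from stub 2, complete its tail by stub 3, conclude by the landed
`strictCertificate_of_design`. [folklore] -/
theorem StrictCertificate_of :
    (∃ a h : ℝ, ∃ (ha : a ≠ 0) (hh : h ≠ 0), 47 / 50 ≤ a ∧ a ≤ 1 ∧ 39 / 50 * a ≤ h ∧ h ≤ 17 / 20 * a ∧ IsLeast (Set.range fun Q : Literature.MathematicalPhysics.StatisticalMechanics.PeriodicConfiguration 3 => Q.energyPerParticle Literature.MathematicalPhysics.StatisticalMechanics.lennardJones) ((Literature.MathematicalPhysics.StatisticalMechanics.hcpPeriodicConfiguration ha hh).energyPerParticle Literature.MathematicalPhysics.StatisticalMechanics.lennardJones)) →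
    (∀ (a h : ℝ) (ha : a ≠ 0) (hh : h ≠ 0), 47 / 50 ≤ a → a ≤ 1 → 39 / 50 * a ≤ h → h ≤ 17 / 20 * a → ∃ (ρ : ℝ) (f : ℝ → ℝ), 0 < ρ ∧ Continuous (fun v : EuclideanSpace ℝ (Fin 3) => (f ‖v‖ : ℂ)) ∧ MeasureTheory.Integrable (fun v : EuclideanSpace ℝ (Fin 3) => (f ‖v‖ : ℂ)) ∧ MeasureTheory.Integrable (FourierTransform.fourier (fun v : EuclideanSpace ℝ (Fin 3) => (f ‖v‖ : ℂ))) ∧ (∀ ξ : EuclideanSpace ℝ (Fin 3), (FourierTransform.fourier (fun v : EuclideanSpace ℝ (Fin 3) => (f ‖v‖ : ℂ)) ξ).im = 0 ∧ 0 ≤ (FourierTransform.fourier (fun v : EuclideanSpace ℝ (Fin 3) => (f ‖v‖ : ℂ)) ξ).re) ∧ (∀ ξ : EuclideanSpace ℝ (Fin 3), ξ ≠ 0 → (∀ k : EuclideanSpace ℝ (Fin 3), (∀ g ∈ (Literature.MathematicalPhysics.StatisticalMechanics.hcpPeriodicConfiguration ha hh).lattice, ∃ n : ℤ, inner ℝ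 k g = (n : ℝ)) → ‖ξ‖ ≠ ‖k‖) → FourierTransform.fourier (fun v : EuclideanSpace ℝ (Fin 3) => (f ‖v‖ : ℂ)) ξ ≠ 0) ∧ FourierTransform.fourier (fun v : EuclideanSpace ℝ (Fin 3) => (f ‖v‖ : ℂ)) 0 = 0 ∧ (∀ r : ℝ, ρ ≤ r → f r ≤ Literature.MathematicalPhysics.StatisticalMechanics.lennardJones r) ∧ (∀ r : ℝ, ρ ≤ r → (f r = Literature.MathematicalPhysics.StatisticalMechanics.lennardJones r ↔ ∃ p ∈ (Literature.MathematicalPhysics.StatisticalMechanics.hcpPeriodicConfiguration ha hh).points, ∃ q ∈ (Literature.MathematicalPhysics.StatisticalMechanics.hcpPeriodicConfiguration ha hh).points, r = dist p q)) ∧ (∀ w : EuclideanSpace ℝ (Fin 3), HasSum (fun y : (Literature.MathematicalPhysics.StatisticalMechanics.hcpPeriodicConfiguration ha hh).points => f (dist w (y : EuclideanSpace ℝ (Fin 3)))) 0)) →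
    (∀ (a h : ℝ) (ha : a ≠ 0) (hh : h ≠ 0), (∀ Q : Literature.MathematicalPhysics.StatisticalMechanics.PeriodicConfiguration 3, (Literature.MathematicalPhysics.StatisticalMechanics.hcpPeriodicConfiguration ha hh).energyPerParticle Literature.MathematicalPhysics.StatisticalMechanics.lennardJones ≤ Q.energyPerParticle Literature.MathematicalPhysics.StatisticalMechanics.lennardJones) → ∀ (ρ : ℝ) (f : ℝ → ℝ), (0 < ρ ∧ Continuous (fun v : EuclideanSpace ℝ (Fin 3) => (f ‖v‖ : ℂ)) ∧ MeasureTheory.Integrable (fun v : EuclideanSpace ℝ (Fin 3) => (f ‖v‖ : ℂ)) ∧ MeasureTheory.Integrable (FourierTransform.fourier (fun v : EuclideanSpace ℝ (Fin 3) => (f ‖v‖ : ℂ))) ∧ (∀ ξ : EuclideanSpace ℝ (Fin 3), (FourierTransform.fourier (fun v : EuclideanSpace ℝ (Fin 3) => (f ‖v‖ : ℂ)) ξ).im = 0 ∧ 0 ≤ (FourierTransform.fourier (fun v : EuclideanSpace ℝ (Fin 3) => (f ‖v‖ : ℂ)) ξ).re) ∧ (∀ ξ : EuclideanSpace ℝ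 (Fin 3), ξ ≠ 0 → (∀ k : EuclideanSpace ℝ (Fin 3), (∀ g ∈ (Literature.MathematicalPhysics.StatisticalMechanics.hcpPeriodicConfiguration ha hh).lattice, ∃ n : ℤ, inner ℝ k g = (n : ℝ)) → ‖ξ‖ ≠ ‖k‖) → FourierTransform.fourier (fun v : EuclideanSpace ℝ (Fin 3) => (f ‖v‖ : ℂ)) ξ ≠ 0) ∧ (∀ r : ℝ, ρ ≤ r → f r ≤ Literature.MathematicalPhysics.StatisticalMechanics.lennardJones r) ∧ (∀ r : ℝ, ρ ≤ r → (f r = Literature.MathematicalPhysics.StatisticalMechanics.lennardJones r ↔ ∃ p ∈ (Literature.MathematicalPhysics.StatisticalMechanics.hcpPeriodicConfiguration ha hh).points, ∃ q ∈ (Literature.MathematicalPhysics.StatisticalMechanics.hcpPeriodicConfiguration ha hh).points, r = dist p q))) → ∃ (ρ' : ℝ) (f' Uc : ℝ → ℝ), ρ ≤ ρ' ∧ (∀ r : ℝ, ρ' ≤ r → f' r = f r) ∧ 0 < ρ' ∧ Continuous (fun v : EuclideanSpace ℝ (Fin 3) => (f' ‖v‖ : ℂ)) ∧ MeasureTheory.Integrable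 (fun v : EuclideanSpace ℝ (Fin 3) => (f' ‖v‖ : ℂ)) ∧ MeasureTheory.Integrable (FourierTransform.fourier (fun v : EuclideanSpace ℝ (Fin 3) => (f' ‖v‖ : ℂ))) ∧ (∀ ξ : EuclideanSpace ℝ (Fin 3), (FourierTransform.fourier (fun v : EuclideanSpace ℝ (Fin 3) => (f' ‖v‖ : ℂ)) ξ).im = 0 ∧ 0 ≤ (FourierTransform.fourier (fun v : EuclideanSpace ℝ (Fin 3) => (f' ‖v‖ : ℂ)) ξ).re) ∧ (∀ ξ : EuclideanSpace ℝ (Fin 3), ξ ≠ 0 → (∀ k : EuclideanSpace ℝ (Fin 3), (∀ g ∈ (Literature.MathematicalPhysics.StatisticalMechanics.hcpPeriodicConfiguration ha hh).lattice, ∃ n : ℤ, inner ℝ k g = (n : ℝ)) → ‖ξ‖ ≠ ‖k‖) → FourierTransform.fourier (fun v : EuclideanSpace ℝ (Fin 3) => (f' ‖v‖ : ℂ)) ξ ≠ 0) ∧ (∀ r : ℝ, ρ' ≤ r → f' r ≤ Literature.MathematicalPhysics.StatisticalMechanics.lennardJones r) ∧ (∀ r : ℝ, ρ' ≤ r → f'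 r = Literature.MathematicalPhysics.StatisticalMechanics.lennardJones r → ∃ p ∈ (Literature.MathematicalPhysics.StatisticalMechanics.hcpPeriodicConfiguration ha hh).points, ∃ q ∈ (Literature.MathematicalPhysics.StatisticalMechanics.hcpPeriodicConfiguration ha hh).points, r = dist p q) ∧ ContinuousOn Uc (Set.Ioc 0 ρ') ∧ (∀ r : ℝ, 0 < r → r < ρ' → 0 ≤ Uc r) ∧ (∀ r : ℝ, 0 < r → r < ρ' → Uc r = 0 → ∃ p ∈ (Literature.MathematicalPhysics.StatisticalMechanics.hcpPeriodicConfiguration ha hh).points, ∃ q ∈ (Literature.MathematicalPhysics.StatisticalMechanics.hcpPeriodicConfiguration ha hh).points, r = dist p q) ∧ Uc ρ' = Literature.MathematicalPhysics.StatisticalMechanics.lennardJones ρ' - f' ρ' ∧ (∀ Q : Literature.MathematicalPhysics.StatisticalMechanics.PeriodicConfiguration 3, (Literature.MathematicalPhysics.StatisticalMechanics.hcpPeriodicConfiguration ha hh).energyPerParticle Literature.MathematicalPhysics.StatisticalMechanics.lennardJones + f' 0 / 2 ≤ Q.energyPerParticle (fun r => if r < ρ' then Literature.MathematicalPhysics.StatisticalMechanics.lennardJones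 r - f' r - Uc r else 0))) →
    Summit.AtomisticToContinuum.Crystallization.Theses.BraggSlacknessRigidity.StrictCertificate := by
  rintro ⟨a, h, ha, hh, h1, h2, h3, h4, hleast⟩ hFF hCC
  have hmin : (∀ Q : Literature.MathematicalPhysics.StatisticalMechanics.PeriodicConfiguration 3, (Literature.MathematicalPhysics.StatisticalMechanics.hcpPeriodicConfiguration ha hh).energyPerParticle Literature.MathematicalPhysics.StatisticalMechanics.lennardJones ≤ Q.energyPerParticle Literature.MathematicalPhysics.StatisticalMechanics.lennardJones) := fun Q => hleast.2 ⟨Q, rfl⟩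
  obtain ⟨ρ, f, hρ, hFc, hFi, hFF', hre, hstrict, -, hle, hiff, -⟩ := hFF a h ha hh h1 h2 h3 h4
  obtain ⟨ρ', f', Uc, -, -, hD⟩ := hCC a h ha hh hmin ρ f ⟨hρ, hFc, hFi, hFF', hre, hstrict, hle, hiff⟩
  exact strictCertificate_of_design a h ha hh ⟨ρ', f', Uc, hD⟩

/-- The crux from the stubs themselves (registered-style alias). [folklore] -/
theorem strictCertificate_of_stubs : Summit.AtomisticToContinuum.Crystallization.Theses.BraggSlacknessRigidity.StrictCertificate :=
  StrictCertificate_of stub_hcpPeriodicMinimiser stub_hcpFarFieldOnBox stub_hcpCoreCompletion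

end Summit.AtomisticToContinuum.Crystallization.Cruxes.StrictCertificate.FarfieldCore

end
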